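import Mathlib
import HarnessLib
import Literature.Analysis.Complex.VitaliConvergence
import Summits.CriticalPhenomena.CardyFormulaZ2.Theorems.CardyQContinuationJetLimitLemma
import Summits.CriticalPhenomena.CardyFormulaZ2.Theses.CardySelfDualSegment

/-!
# Route `CardySelfDualSegment`, crux `SegmentOpen`, line `Sketch` — stub `stub_vitaliJets`

**Vitali's convergence theorem with jets** (Vitali 1903 / Porter 1904; Remmert, *Classical
topics in complex function theory*, §7.3): a locally bounded sequence of holomorphic functions
`F n` on a preconnected open `U ⊆ ℂ`, all of whose jets `(F n)⁽ᵏ⁾(z₀)` at one point `z₀ ∈ U`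
converge (to `c k`), converges locally uniformly on `U` to a holomorphic `f` with
`f⁽ᵏ⁾(z₀) = c k` for every `k`.

Proof: Montel's theorem and the subsequence principle
(`Literature.Analysis.Complex.exists_tendstoLocallyUniformlyOn_of_unique_limits`); uniqueness of
the subsequential limits by the jet form of the identity theorem (equal jets at `z₀` ⇒ equal on a
disc about `z₀` by Taylor's theorem `Complex.taylorSeries_eq_on_ball`, then
`AnalyticOnNhd.eqOn_of_preconnected_of_eventuallyEq`), the jets passing to locally uniform
limits by Weierstrass' theorem (`TendstoLocallyUniformlyOn.deriv`, iterated). This is exactly the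
sequence form already assembled in the tree for route `CardyQContinuation`,
`JetLimit.exists_tendstoLocallyUniformlyOn_of_tendsto_iteratedDeriv`
(`Summits/CriticalPhenomena/CardyFormulaZ2/Theorems/CardyQContinuationJetLimitLemma.lean`), which
we invoke. Used by the glue `stub_goodSetNhdsZero_of_jets` of line `Sketch` (convergence of the
complex crossing polynomials on a disc once all their Taylor coefficients at `0` converge).
-/

noncomputable section

namespace Summit.CriticalPhenomena.CardyFormulaZ2.Theorems

open Literature.Probability Literature.Barriers.CriticalPhenomena
open Literature.Probability.RandomPlanarGeometry (ConformalRectangle ConformalEquiv MarkedDomain)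
open Filter Set Topology MeasureTheory
open UpperHalfPlane (upperHalfPlaneSet)

/-- **Vitali's convergence theorem with jets.** Let `U ⊆ ℂ` be open and preconnected, `z₀ ∈ U`,
and let `F n` be holomorphic on `U` and locally bounded, uniformly in `n`. If for every `k` the
`k`-th derivatives `(F n)⁽ᵏ⁾(z₀)` converge to `c k`, then `F n → f` locally uniformly on `U` for a
holomorphic `f` with `f⁽ᵏ⁾(z₀) = c k` for all `k` (Montel + identity theorem in jet form +
Weierstrass). [folklore] -/
theorem stub_vitaliJets :
    ∀ (U : Set ℂ), IsOpen U → IsPreconnected U → ∀ z₀ ∈ U, ∀ (F : ℕ → ℂ → ℂ) (c : ℕ → ℂ),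
      (∀ n, DifferentiableOn ℂ (F n) U) →
      (∀ a ∈ U, ∃ M : ℝ, ∃ r > 0, ∀ n, ∀ z ∈ Metric.ball a r ∩ U, ‖F n z‖ ≤ M) →
      (∀ k : ℕ, Tendsto (fun n => iteratedDeriv k (F n) z₀) atTop (𝓝 (c k))) →
      ∃ f : ℂ → ℂ, DifferentiableOn ℂ f U ∧ TendstoLocallyUniformlyOn F f atTop U ∧
        ∀ k : ℕ, iteratedDeriv k f z₀ = c k :=
  fun _U hU hUc _z₀ hz₀ _F _c hF hb hc =>
    JetLimit.exists_tendstoLocallyUniformlyOn_of_tendsto_iteratedDeriv hU hUc hF hb hz₀ hc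

end Summit.CriticalPhenomena.CardyFormulaZ2.Theorems

end
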